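import Summits.HodgeConjecture.HodgeConjecture.Theses.PadicSemiregularLift
import Literature.AlgebraicGeometry.HodgeTheory.SemiregularityMap

/-!
# `PadicPridhamSemiregularity` (stmt-HodgeConjecture-13815) · Negative · the torsor test

Negative-side knowledge for the informal crux `PadicSemiregularLift.PadicPridhamSemiregularity`
(P1b: "σ_q(o(E_n)) = gr^q Ob_n([E_n])"; "p-adically semiregular ⇒ class-lifts-imply-object-lifts"),
extracted from the standing disprover's work file `Cruxes/PadicPridhamSemiregularity/Disproof.lean` §6
(refuter-cdisprove-stmt-HodgeConjecture-13815-g2-0, cycle 2, 2026-08-16) so that planners restating the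
crux and leads building a line can import it.

THE TORSOR TEST. Every K₀-free restatement of P1b (the cards' P1b♮ / Pridham shape (i″):
`ι ⊕_q σ_q(o(E_n)) = ± δ_{n+1}(ch^cris E₁)` for EVERY lift `E_n` of `E₁`) has a lift-independent
right-hand side, so its left-hand side must be lift-independent too. Two lifts `F`, `F + e`
(`e ∈ Ext¹(E₁,E₁)`) of the same bundle across a square-zero step of the p-adic tower have
`o(F + e) = o(F) + β(e) + [n = 2]·(e ∘ e)` (Bockstein + Yoneda square; Čech derivation in the work
file), hence `σ_q(o(F+e)) − σ_q(o(F)) = σ_q(β(e)) + [n = 2]·σ_q(e ∘ e)`. The theorems below show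
`σ_q(e ∘ e) = 0` for ALL `e`, in every characteristic with `2` invertible, from the two structural
properties of the geometric Atiyah–trace algebra — graded CENTRALITY of the Atiyah class
(Buchweitz–Flenner Prop. 3.12) and graded CYCLICITY of Illusie's trace (BF Cor. 4.8) — carried as
explicit hypotheses because the tree's carrier `HodgeTheory.AtiyahTraceAlgebra` has `σ` as free data.
Consequently the only lift-dependence is the Bockstein image `σ(β(e))`, which is what Hodge-torsion-
freeness kills: the test refutes nothing and locates `H_tf`. By-product (`sq_eq_zero_of_isSemiregular`):
a p-adically semiregular bundle has `x ∘ x = 0` for every `x ∈ Ext¹` — a free necessary condition for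
the seeds of the sibling crux `SemiregularSeedsOnAnchors`.
-/

noncomputable section

namespace Summit.HodgeConjecture.HodgeConjecture.Theorems.PadicPridhamSemiregularity.Negative

open Literature.AlgebraicGeometry.HodgeTheory

universe u v

section TorsorTest

variable {𝕜 : Type u} [CommRing 𝕜] {A : AtiyahTraceAlgebra.{u, v} 𝕜}

/-- `At^k · x = (-1)^k x · At^k` for `x ∈ Ext¹(F,F)`, from graded centrality of `At` in the shape of
Buchweitz–Flenner Prop. 3.12 with `k = 1` (hypothesis `hC`: `At · ξ = (-1)^i ξ · At` for
`ξ ∈ Extⁱ(F,F)` — true for the Atiyah class of any perfect complex, `At_{F[i]} = (-1)^i At_F[i]`, BF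
Sit. 3.7) and associativity of the Yoneda product. [cite: BuchweitzFlenner2003, Prop. 3.12 and Sit. 3.7] -/
theorem atiyahPow_mul_comm
    (hC : ∀ (i a : ℕ) (ha : 1 + i = a) (ha' : i + 1 = a) (x : A.Ext i 0),
      A.mul ha (show 1 + 0 = 1 from rfl) A.atiyah x =
        ((-1 : 𝕜) ^ i) • A.mul ha' (show 0 + 1 = 1 from rfl) x A.atiyah)
    (x : A.Ext 1 0) (k : ℕ) :
    A.mul rfl (Nat.add_zero k) (A.atiyahPow k) x =
      ((-1 : 𝕜) ^ k) • A.mul (Nat.add_comm 1 k) (Nat.zero_add k) x (A.atiyahPow k) := by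
  induction k with
  | zero =>
    rw [pow_zero, one_smul, AtiyahTraceAlgebra.atiyahPow_zero]
    exact (A.one_mul x).trans (A.mul_one x).symm
  | succ k ih =>
    rw [AtiyahTraceAlgebra.atiyahPow_succ]
    rw [A.mul_assoc rfl rfl (rfl : 1 + 1 = 2) (rfl : 1 + 0 = 1) rfl (Nat.add_zero (k + 1))
      (rfl : k + 2 = k + 1 + 1) (rfl : k + 1 = k + 1) (A.atiyahPow k) A.atiyah x]
    rw [hC 1 2 rfl rfl x, map_smul]
    rw [← A.mul_assoc (rfl : k + 1 = k + 1) (Nat.add_zero k) (rfl : 1 + 1 = 2) (rfl : 0 + 1 = 1)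
      (rfl : k + 1 + 1 = k + 1 + 1) (rfl : k + 1 = k + 1) (rfl : k + 2 = k + 1 + 1)
      (rfl : k + 1 = k + 1) (A.atiyahPow k) x A.atiyah]
    rw [ih, LinearMap.map_smul₂]
    rw [A.mul_assoc (Nat.add_comm 1 k) (Nat.zero_add k) rfl rfl rfl rfl (Nat.add_comm 1 (k + 1))
      (Nat.zero_add (k + 1)) x (A.atiyahPow k) A.atiyah]
    rw [smul_smul, pow_one, ← pow_succ']

variable
  (hC : ∀ (i a : ℕ) (ha : 1 + i = a) (ha' : i + 1 = a) (x : A.Ext i 0),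
    A.mul ha (show 1 + 0 = 1 from rfl) A.atiyah x =
      ((-1 : 𝕜) ^ i) • A.mul ha' (show 0 + 1 = 1 from rfl) x A.atiyah)
  (hT : ∀ (i j i' j' a b : ℕ) (ha : i + i' = a) (hb : j + j' = b) (ha' : i' + i = a)
    (hb' : j' + j = b) (y : A.Ext i j) (z : A.Ext i' j'),
    A.trace a b (A.mul ha hb y z) =
      ((-1 : 𝕜) ^ (i * i' + j * j')) • A.trace a b (A.mul ha' hb' z y))
include hC hT

/-- **The sign computation** `2 · Tr((x ∘ x) · At^k) = 0` for `x ∈ Ext¹(F,F)`, from centrality (`hC`)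
and graded cyclicity of the trace (`hT`: `Tr(y·z) = (-1)^{ii'+jj'} Tr(z·y)` — "the trace vanishes on
graded commutators", BF before Cor. 4.8) alone:
`Tr((xx)P) = Tr(x(xP)) = (-1)^{k+1}Tr((xP)x) = (-1)^{k+1}Tr(x(Px)) = (-1)^{2k+1}Tr(x(xP)) = −Tr((xx)P)`.
[cite: BuchweitzFlenner2003, Cor. 4.8] -/
theorem two_smul_trace_sq_mul_atiyahPow (k : ℕ) (x : A.Ext 1 0) :
    (2 : 𝕜) • A.trace (k + 2) k
      (A.mul (Nat.add_comm 2 k) (Nat.zero_add k) (A.mul (rfl : 1 + 1 = 2) (rfl : 0 + 0 = 0) x x)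
        (A.atiyahPow k)) = 0 := by
  set S := A.trace (k + 2) k
      (A.mul (Nat.add_comm 2 k) (Nat.zero_add k) (A.mul (rfl : 1 + 1 = 2) (rfl : 0 + 0 = 0) x x)
        (A.atiyahPow k)) with hS
  have key : S = (((-1 : 𝕜) ^ (1 * (k + 1) + 0 * k)) * (-1) ^ k) • S := by
    conv_lhs =>
      rw [hS]
      rw [A.mul_assoc (rfl : 1 + 1 = 2) (rfl : 0 + 0 = 0) (Nat.add_comm 1 k) (Nat.zero_add k)
        (Nat.add_comm 2 k) (Nat.zero_add k) (show 1 + (k + 1) = k + 2 by omega) (Nat.zero_add k)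
        x x (A.atiyahPow k)]
      rw [hT 1 0 (k + 1) k (k + 2) k (show 1 + (k + 1) = k + 2 by omega) (Nat.zero_add k)
        rfl (Nat.add_zero k)]
      rw [A.mul_assoc (Nat.add_comm 1 k) (Nat.zero_add k) (rfl : k + 1 = k + 1) (Nat.add_zero k)
        (rfl : k + 1 + 1 = k + 2) (Nat.add_zero k) (show 1 + (k + 1) = k + 2 by omega)
        (Nat.zero_add k) x (A.atiyahPow k) x]
      rw [atiyahPow_mul_comm hC x k, map_smul, map_smul]
      rw [← A.mul_assoc (rfl : 1 + 1 = 2) (rfl : 0 + 0 = 0) (Nat.add_comm 1 k) (Nat.zero_add k)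
        (Nat.add_comm 2 k) (Nat.zero_add k) (show 1 + (k + 1) = k + 2 by omega) (Nat.zero_add k)
        x x (A.atiyahPow k)]
      rw [smul_smul]
  have hsign : ((-1 : 𝕜) ^ (1 * (k + 1) + 0 * k)) * (-1) ^ k = -1 := by
    rw [← pow_add]
    exact Odd.neg_one_pow ⟨k, by ring⟩
  rw [hsign, neg_one_smul] at key
  rw [two_smul]
  nth_rewrite 2 [key]
  exact add_neg_cancel S

/-- **`2 · σ_k(x ∘ x) = 0`** for all `x ∈ Ext¹(F,F)` and all `k`: the p-adic Buchweitz–Flenner map kills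
the doubles of all primary obstructions, in any characteristic (BF Cor. 4.8, there over `ℂ`).
[cite: BuchweitzFlenner2003, Cor. 4.8] -/
theorem two_smul_semiregularityComponent_sq (k : ℕ) (x : A.Ext 1 0) :
    (2 : 𝕜) • A.semiregularityComponent k (A.mul (rfl : 1 + 1 = 2) (rfl : 0 + 0 = 0) x x) = 0 := by
  rw [AtiyahTraceAlgebra.semiregularityComponent_apply, smul_comm,
    two_smul_trace_sq_mul_atiyahPow hC hT, smul_zero]

/-- **`σ_k(x ∘ x) = 0` when `2` is invertible** (`𝕜 = W_n(k)`, `p` odd): for two vector-bundle lifts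
`F`, `F + e` of the same bundle across a square-zero step of the p-adic tower,
`σ_k(o(F + e)) − σ_k(o(F)) = σ_k(β(e))` exactly — the left side of any K₀-free restatement of P1b is
lift-independent up to a Bockstein image. [cite: BuchweitzFlenner2003, Cor. 4.8] -/
theorem semiregularityComponent_sq_eq_zero [Invertible (2 : 𝕜)] (k : ℕ) (x : A.Ext 1 0) :
    A.semiregularityComponent k (A.mul (rfl : 1 + 1 = 2) (rfl : 0 + 0 = 0) x x) = 0 := by
  have h := two_smul_semiregularityComponent_sq hC hT k x
  calc A.semiregularityComponent k (A.mul (rfl : 1 + 1 = 2) (rfl : 0 + 0 = 0) x x)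
      = (⅟(2 : 𝕜) * 2) •
          A.semiregularityComponent k (A.mul (rfl : 1 + 1 = 2) (rfl : 0 + 0 = 0) x x) := by
        rw [invOf_mul_self, one_smul]
    _ = 0 := by rw [← smul_smul, h, smul_zero]

/-- **The whole semiregularity map kills primary obstructions** (`2` invertible): `σ(x ∘ x) = 0` in
`∏_k H^{k+2}(X, Ω^k)`. [cite: BuchweitzFlenner2003, Cor. 4.8] -/
theorem semiregularityMap_sq_eq_zero [Invertible (2 : 𝕜)] (x : A.Ext 1 0) :
    A.semiregularityMap (A.mul (rfl : 1 + 1 = 2) (rfl : 0 + 0 = 0) x x) = 0 := by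
  funext k
  rw [AtiyahTraceAlgebra.semiregularityMap_apply, semiregularityComponent_sq_eq_zero hC hT]
  rfl

/-- **Semiregular ⇒ all Yoneda squares on `Ext¹` vanish** (`2` invertible): a p-adically semiregular
`E₁` has `x ∘ x = 0` for every `x ∈ Ext¹(E₁,E₁)`, i.e. its equal-characteristic deformations are
unobstructed to second order; contrapositively, a candidate seed with some `x ∘ x ≠ 0` is not
semiregular. [cite: BuchweitzFlenner2003, Cor. 4.8] -/
theorem sq_eq_zero_of_isSemiregular [Invertible (2 : 𝕜)] (hσ : A.IsSemiregular) (x : A.Ext 1 0) :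
    A.mul (rfl : 1 + 1 = 2) (rfl : 0 + 0 = 0) x x = 0 :=
  hσ (by rw [semiregularityMap_sq_eq_zero hC hT, map_zero])

end TorsorTest

end Summit.HodgeConjecture.HodgeConjecture.Theorems.PadicPridhamSemiregularity.Negative
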